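import Mathlib
import Literature.Analysis.FunctionSpaces.WeakL1LimitsProofs
import Summits.NavierStokesRegularity.NavierStokesRegularity.Theorems.SlicedKelvinPlanarFluxAPrioriHeatKernel1D

/-!
# Crux `SlicedKelvin.PlanarFluxAPriori` (stmt-NavierStokesRegularity-15600), line `registered`:
  calculus of the caloric pairing `τ ↦ ∫ G_{ν(t−τ)}(c₀ − c) φ(τ, c) dc` (helper for `stub_heatKernelDomination`)

Second of three files proving the one-dimensional HEAT DUALITY (Duhamel comparison) bound used by the
heat-kernel domination step of the skeleton `Cruxes/PlanarFluxAPriori/Lines/birth.lean`: a bounded classical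
subsolution `φ` of `∂_τ − ν∂_c²` on `[0,t] × ℝ` is tested against the heat kernel `G_{ν(t−τ)}(c₀ − c)` of the
elapsed time, and the pairing `I(τ) = ∫ G φ(τ,·)` is differentiated in `τ`. This file proves:

* (imported: the tree's `Literature.Analysis.FunctionSpaces.ofReal_integral_le_lintegral_ofReal'`,
  `ofReal (∫ f) ≤ ∫⁻ ofReal f` for every real `f` — the passage to the `ℝ≥0∞` currency of the stub);
* `continuous_slice_right`, `continuousOn_slice_left` — slices of jointly continuous `φ(τ, c)`;
* `integral_heatKernel_sub_second_deriv_mul` — TWO INTEGRATIONS BY PARTS: `∫ ∂_c²[G_s(c₀−c)] f = ∫ G_s(c₀−c) f''`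
  for `f ∈ C²` with `f, f', f''` bounded (Mathlib `integral_mul_deriv_eq_deriv_mul_of_integrable` twice);
* `hasDerivAt_integral_heatKernel_mul` — DIFFERENTIATION UNDER THE INTEGRAL SIGN:
  `I'(τ₀) = ∫ (G φₜ − ν (∂_sG) φ)(τ₀, c) dc` (Mathlib `hasDerivAt_integral_of_dominated_loc_of_deriv_le`, the
  elapsed times near `τ₀` staying in `[s₀/2, 2s₀]` where `G`, `|∂_sG|` have a common Gaussian majorant);
* `continuousAt_integral_heatKernel_mul` — continuity in `τ` of `∫ G H(τ,·)` for jointly continuous bounded `H`.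

Mathlib and the tree's heat kernel (`Literature.Analysis.UnboundedOperators.heatKernel`) only; no fluid
mechanics enters.
-/

noncomputable section

-- Problem = summit for this single-conjunct summit: the duplicate namespace component is deliberate.
set_option linter.dupNamespace false

namespace Summit.NavierStokesRegularity.NavierStokesRegularity.Theorems.SlicedKelvinPlanarFluxAPriori

open MeasureTheory Set Real Filter Topology ENNReal
open Literature.Analysis.UnboundedOperators

/-! ### Tools -/

/-- Slices of a jointly continuous function of `(τ, c)` are continuous in `c`. -/
theorem continuous_slice_right {φ : ℝ → ℝ → ℝ} {S : Set ℝ}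
    (h : ContinuousOn (Function.uncurry φ) (S ×ˢ univ)) {τ : ℝ} (hτ : τ ∈ S) : Continuous (φ τ) := by
  have hc : Continuous fun c : ℝ => ((τ, c) : ℝ × ℝ) := continuous_const.prodMk continuous_id
  exact h.comp_continuous hc fun c => mk_mem_prod hτ (mem_univ c)

/-- Slices of a jointly continuous function of `(τ, c)` are continuous in `τ` on the time set. -/
theorem continuousOn_slice_left {φ : ℝ → ℝ → ℝ} {S : Set ℝ}
    (h : ContinuousOn (Function.uncurry φ) (S ×ˢ univ)) (c : ℝ) : ContinuousOn (fun τ => φ τ c) S := by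
  have hc : Continuous fun τ : ℝ => ((τ, c) : ℝ × ℝ) := continuous_id.prodMk continuous_const
  exact h.comp hc.continuousOn fun τ hτ => mk_mem_prod hτ (mem_univ c)

/-- **Two integrations by parts against the kernel.** For `f ∈ C²(ℝ)` with `f, f', f''` bounded
(`f''` continuous) and `0 < s`: `∫ ∂_c²[G_s(c₀ − c)] f(c) dc = ∫ G_s(c₀ − c) f''(c) dc` (no boundary terms:
Mathlib's `integral_mul_deriv_eq_deriv_mul_of_integrable` twice, all products being bounded × Gaussian). -/
theorem integral_heatKernel_sub_second_deriv_mul {s : ℝ} (hs : 0 < s) (c₀ : ℝ) {f f₁ f₂ : ℝ → ℝ} {B : ℝ}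
    (hf1 : ∀ c, HasDerivAt f (f₁ c) c) (hf2 : ∀ c, HasDerivAt f₁ (f₂ c) c) (hf2c : Continuous f₂)
    (hfB : ∀ c, |f c| ≤ B) (hf1B : ∀ c, |f₁ c| ≤ B) (hf2B : ∀ c, |f₂ c| ≤ B) :
    ∫ c, ((c₀ - c) ^ 2 / (4 * s ^ 2) - 1 / (2 * s)) * heatKernel s (c₀ - c) * f c =
      ∫ c, heatKernel s (c₀ - c) * f₂ c := by
  -- the kernel and its two derivatives
  set k : ℝ → ℝ := fun c => heatKernel s (c₀ - c) with hk
  set k₁ : ℝ → ℝ := fun c => heatKernel s (c₀ - c) * ((c₀ - c) / (2 * s)) with hk₁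
  set k₂ : ℝ → ℝ := fun c => ((c₀ - c) ^ 2 / (4 * s ^ 2) - 1 / (2 * s)) * heatKernel s (c₀ - c) with hk₂
  have hk' : ∀ c, HasDerivAt k (k₁ c) c := fun c => hasDerivAt_heatKernel_sub hs.ne' c₀ c
  have hk₁' : ∀ c, HasDerivAt k₁ (k₂ c) c := fun c => hasDerivAt_heatKernel_sub_deriv hs.ne' c₀ c
  -- continuity / measurability
  have hfc : Continuous f := continuous_iff_continuousAt.2 fun c => (hf1 c).continuousAt
  have hf1c : Continuous f₁ := continuous_iff_continuousAt.2 fun c => (hf2 c).continuousAt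
  have hkc : Continuous k := (continuous_heatKernel (E := ℝ) s).comp (continuous_const.sub continuous_id)
  have hk₁c : Continuous k₁ := continuous_iff_continuousAt.2 fun c => (hk₁' c).continuousAt
  have hk₂c : Continuous k₂ := by
    have hw : Continuous fun c : ℝ => (c₀ - c) ^ 2 / (4 * s ^ 2) - 1 / (2 * s) := by fun_prop
    exact hw.mul hkc
  -- Gaussian domination of k, k₁, k₂ at the fixed time s (s ∈ [s/2, 2s])
  have hsI : s ∈ Icc (s / 2) (2 * s) := ⟨by linarith, by linarith⟩
  have hb : 0 < 1 / (16 * s) := by positivity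
  set A : ℝ := (4 * π * (s / 2)) ^ (-(1 : ℝ) / 2) with hA
  have hA0 : 0 ≤ A := by positivity
  have hk_le : ∀ c, |k c| ≤ A * Real.exp (-(1 / (16 * s)) * (c₀ - c) ^ 2) := by
    intro c
    rw [abs_of_nonneg (heatKernel_real_nonneg hs _)]
    refine (heatKernel_le_gaussian_of_mem_Icc hs hsI (c₀ - c)).trans ?_
    refine mul_le_mul_of_nonneg_left (Real.exp_le_exp.2 ?_) hA0
    refine mul_le_mul_of_nonneg_right (neg_le_neg ?_) (by positivity)
    exact one_div_le_one_div_of_le (by positivity) (by linarith)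
  obtain ⟨C₁, hC₁0, hC₁⟩ := abs_drift_mul_heatKernel_le_gaussian_of_mem_Icc hs
  obtain ⟨C₂, hC₂0, hC₂⟩ := abs_weight_mul_heatKernel_le_gaussian_of_mem_Icc hs
  have hk₁_le : ∀ c, |k₁ c| ≤ C₁ * Real.exp (-(1 / (16 * s)) * (c₀ - c) ^ 2) := by
    intro c
    have h := hC₁ s hsI (c₀ - c)
    rw [hk₁]; dsimp only
    rw [abs_mul, abs_of_nonneg (heatKernel_real_nonneg hs _), mul_comm]
    exact h
  have hk₂_le : ∀ c, |k₂ c| ≤ C₂ * Real.exp (-(1 / (16 * s)) * (c₀ - c) ^ 2) := by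
    intro c
    have h := hC₂ s hsI (c₀ - c)
    rw [hk₂]; dsimp only
    rw [abs_mul, abs_of_nonneg (heatKernel_real_nonneg hs _)]
    exact h
  -- integrability of the five products
  have hB0 : 0 ≤ B := (abs_nonneg _).trans (hfB 0)
  have hprod : ∀ {u w : ℝ → ℝ} {Cu Cw : ℝ}, Continuous u → Continuous w → (∀ c, |u c| ≤ Cu) →
      (∀ c, |w c| ≤ Cw * Real.exp (-(1 / (16 * s)) * (c₀ - c) ^ 2)) → 0 ≤ Cu →
      Integrable (u * w) := by
    intro u w Cu Cw hu hw huB hwB hCu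
    refine integrable_of_abs_le_gaussian hb c₀ (C := Cu * Cw) (hu.mul hw).aestronglyMeasurable ?_
    intro c
    rw [Pi.mul_apply, abs_mul, mul_assoc]
    exact mul_le_mul (huB c) (hwB c) (abs_nonneg _) hCu
  have i1 : Integrable (f * k₂) := hprod hfc hk₂c hfB hk₂_le hB0
  have i2 : Integrable (f₁ * k₁) := hprod hf1c hk₁c hf1B hk₁_le hB0
  have i3 : Integrable (f * k₁) := hprod hfc hk₁c hfB hk₁_le hB0
  have i4 : Integrable (f₂ * k) := hprod hf2c hkc hf2B hk_le hB0
  have i5 : Integrable (f₁ * k) := hprod hf1c hkc hf1B hk_le hB0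
  -- first integration by parts: ∫ f k₂ = -∫ f₁ k₁
  have e1 : ∫ c, f c * k₂ c = -∫ c, f₁ c * k₁ c :=
    integral_mul_deriv_eq_deriv_mul_of_integrable (u := f) (u' := f₁) (v := k₁) (v' := k₂)
      (fun c _ => hf1 c) (fun c _ => hk₁' c) i1 i2 i3
  -- second integration by parts: ∫ f₁ k₁ = -∫ f₂ k
  have e2 : ∫ c, f₁ c * k₁ c = -∫ c, f₂ c * k c :=
    integral_mul_deriv_eq_deriv_mul_of_integrable (u := f₁) (u' := f₂) (v := k) (v' := k₁)
      (fun c _ => hf2 c) (fun c _ => hk' c) i2 i4 i5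
  calc ∫ c, ((c₀ - c) ^ 2 / (4 * s ^ 2) - 1 / (2 * s)) * heatKernel s (c₀ - c) * f c
      = ∫ c, f c * k₂ c := integral_congr_ae (ae_of_all _ fun c => by simp only [hk₂]; ring)
    _ = ∫ c, f₂ c * k c := by rw [e1, e2, neg_neg]
    _ = ∫ c, heatKernel s (c₀ - c) * f₂ c := integral_congr_ae (ae_of_all _ fun c => by
          simp only [hk]; ring)

/-- **Differentiating the caloric pairing under the integral sign.** For `φ(τ, ·)` continuous and bounded
by `B` on `(0,t) × ℝ` with time derivative `φₜ` bounded by `B` (and `φₜ(τ₀, ·)` continuous), the pairing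
`τ ↦ ∫ G_{ν(t−τ)}(c₀ − c) φ(τ, c) dc` is differentiable at `τ₀ ∈ (0,t)` with derivative
`∫ (G φₜ − ν (∂_s G) φ)(τ₀, c) dc`, `∂_s G_s(z) = (z²/(4s²) − 1/(2s)) G_s(z)` (dominated convergence: for `τ`
near `τ₀` the elapsed times `ν(t−τ)` stay in `[s₀/2, 2s₀]`, where `G` and `|∂_sG|` have a common Gaussian
majorant). -/
theorem hasDerivAt_integral_heatKernel_mul : ∀ (ν t B : ℝ), 0 < ν → ∀ (φ φₜ : ℝ → ℝ → ℝ) (τ₀ : ℝ), τ₀ ∈ Set.Ioo 0 t → (∀ τ ∈ Set.Ioo 0 t, Continuous (φ τ)) → Continuous (φₜ τ₀) → (∀ τ ∈ Set.Ioo 0 t, ∀ c, HasDerivAt (fun σ => φ σ c) (φₜ τ c) τ) → (∀ τ ∈ Set.Ioo 0 t, ∀ c, |φ τ c| ≤ B) → (∀ τ ∈ Set.Ioo 0 t, ∀ c, |φₜ τ c| ≤ B) → ∀ (c₀ : ℝ), HasDerivAt (fun τ => ∫ c, Literature.Analysis.UnboundedOperators.heatKernel (ν * (t - τ)) (c₀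 - c) * φ τ c) (∫ c, (Literature.Analysis.UnboundedOperators.heatKernel (ν * (t - τ₀)) (c₀ - c) * φₜ τ₀ c - ν * (((c₀ - c) ^ 2 / (4 * (ν * (t - τ₀)) ^ 2) - 1 / (2 * (ν * (t - τ₀)))) * Literature.Analysis.UnboundedOperators.heatKernel (ν * (t - τ₀)) (c₀ - c)) * φ τ₀ c)) τ₀ := by
  intro ν t B hν φ φₜ τ₀ hτ₀ hφc hφtc hdt hB hBt c₀
  set s₀ : ℝ := ν * (t - τ₀) with hs₀
  have hs₀pos : 0 < s₀ := mul_pos hν (by linarith [hτ₀.2])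
  -- the ball of times
  set r : ℝ := min τ₀ ((t - τ₀) / 2) with hr
  have hr0 : 0 < r := lt_min hτ₀.1 (by linarith [hτ₀.2])
  have hball : ∀ τ ∈ Metric.ball τ₀ r, τ ∈ Ioo 0 t ∧ ν * (t - τ) ∈ Icc (s₀ / 2) (2 * s₀) := by
    intro τ hτ
    rw [Metric.mem_ball, Real.dist_eq, abs_lt] at hτ
    have h1 : r ≤ τ₀ := min_le_left _ _
    have h2 : r ≤ (t - τ₀) / 2 := min_le_right _ _
    refine ⟨⟨by linarith, by linarith⟩, ?_, ?_⟩
    · rw [hs₀]; nlinarith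
    · rw [hs₀]; nlinarith
  -- the integrands
  set F : ℝ → ℝ → ℝ := fun τ c => heatKernel (ν * (t - τ)) (c₀ - c) * φ τ c with hF
  set F' : ℝ → ℝ → ℝ := fun τ c => heatKernel (ν * (t - τ)) (c₀ - c) * φₜ τ c -
      ν * (((c₀ - c) ^ 2 / (4 * (ν * (t - τ)) ^ 2) - 1 / (2 * (ν * (t - τ)))) *
        heatKernel (ν * (t - τ)) (c₀ - c)) * φ τ c with hF'
  -- Gaussian majorants on the ball
  obtain ⟨C₂, hC₂0, hC₂⟩ := abs_weight_mul_heatKernel_le_gaussian_of_mem_Icc hs₀pos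
  set A : ℝ := (4 * π * (s₀ / 2)) ^ (-(1 : ℝ) / 2) with hA
  have hA0 : 0 ≤ A := by positivity
  have hB0 : 0 ≤ B := (abs_nonneg _).trans (hB τ₀ hτ₀ 0)
  have hb : 0 < 1 / (16 * s₀) := by positivity
  set bound : ℝ → ℝ := fun c => (A * B + ν * C₂ * B) * Real.exp (-(1 / (16 * s₀)) * (c₀ - c) ^ 2)
    with hbound
  have hG_le : ∀ τ ∈ Metric.ball τ₀ r, ∀ c, |heatKernel (ν * (t - τ)) (c₀ - c)| ≤
      A * Real.exp (-(1 / (16 * s₀)) * (c₀ - c) ^ 2) := by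
    intro τ hτ c
    obtain ⟨hτI, hsI⟩ := hball τ hτ
    have hs : 0 < ν * (t - τ) := by linarith [hsI.1]
    rw [abs_of_nonneg (heatKernel_real_nonneg hs _)]
    refine (heatKernel_le_gaussian_of_mem_Icc hs₀pos hsI (c₀ - c)).trans ?_
    refine mul_le_mul_of_nonneg_left (Real.exp_le_exp.2 ?_) hA0
    refine mul_le_mul_of_nonneg_right (neg_le_neg ?_) (by positivity)
    exact one_div_le_one_div_of_le (by positivity) (by linarith)
  have hF'_le : ∀ τ ∈ Metric.ball τ₀ r, ∀ c, |F' τ c| ≤ bound c := by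
    intro τ hτ c
    obtain ⟨hτI, hsI⟩ := hball τ hτ
    have hs : 0 < ν * (t - τ) := by linarith [hsI.1]
    have h1 : |heatKernel (ν * (t - τ)) (c₀ - c) * φₜ τ c| ≤
        A * Real.exp (-(1 / (16 * s₀)) * (c₀ - c) ^ 2) * B := by
      rw [abs_mul]
      exact mul_le_mul (hG_le τ hτ c) (hBt τ hτI c) (abs_nonneg _) (by positivity)
    have h2 : |ν * (((c₀ - c) ^ 2 / (4 * (ν * (t - τ)) ^ 2) - 1 / (2 * (ν * (t - τ)))) *
        heatKernel (ν * (t - τ)) (c₀ - c)) * φ τ c| ≤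
        ν * (C₂ * Real.exp (-(1 / (16 * s₀)) * (c₀ - c) ^ 2)) * B := by
      rw [abs_mul, abs_mul, abs_of_pos hν]
      refine mul_le_mul (mul_le_mul_of_nonneg_left ?_ hν.le) (hB τ hτI c) (abs_nonneg _)
        (by positivity)
      rw [abs_mul, abs_of_nonneg (heatKernel_real_nonneg hs _)]
      exact hC₂ _ hsI (c₀ - c)
    calc |F' τ c| ≤ |heatKernel (ν * (t - τ)) (c₀ - c) * φₜ τ c| +
          |ν * (((c₀ - c) ^ 2 / (4 * (ν * (t - τ)) ^ 2) - 1 / (2 * (ν * (t - τ)))) *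
            heatKernel (ν * (t - τ)) (c₀ - c)) * φ τ c| := abs_sub _ _
      _ ≤ A * Real.exp (-(1 / (16 * s₀)) * (c₀ - c) ^ 2) * B +
          ν * (C₂ * Real.exp (-(1 / (16 * s₀)) * (c₀ - c) ^ 2)) * B := add_le_add h1 h2
      _ = bound c := by simp only [hbound]; ring
  have hball_mem : Metric.ball τ₀ r ∈ 𝓝 τ₀ := Metric.ball_mem_nhds τ₀ hr0
  -- the six inputs of the dominated differentiation theorem
  have hGcont : ∀ τ, Continuous fun c => heatKernel (ν * (t - τ)) (c₀ - c) := fun τ =>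
    (continuous_heatKernel (E := ℝ) _).comp (continuous_const.sub continuous_id)
  have hmeas : ∀ᶠ τ in 𝓝 τ₀, AEStronglyMeasurable (F τ) volume := by
    filter_upwards [hball_mem] with τ hτ
    exact ((hGcont τ).mul (hφc τ (hball τ hτ).1)).aestronglyMeasurable
  have hint : Integrable (F τ₀) := by
    refine integrable_of_abs_le_gaussian hb c₀ (C := A * B)
      ((hGcont τ₀).mul (hφc τ₀ hτ₀)).aestronglyMeasurable fun c => ?_
    simp only [hF]
    rw [abs_mul, mul_assoc, mul_comm B, ← mul_assoc]
    exact mul_le_mul (hG_le τ₀ (Metric.mem_ball_self hr0) c) (hB τ₀ hτ₀ c) (abs_nonneg _)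
      (by positivity)
  have hmeas' : AEStronglyMeasurable (F' τ₀) volume := by
    refine Continuous.aestronglyMeasurable ?_
    simp only [hF']
    have hw : Continuous fun c : ℝ =>
        (c₀ - c) ^ 2 / (4 * (ν * (t - τ₀)) ^ 2) - 1 / (2 * (ν * (t - τ₀))) := by fun_prop
    exact ((hGcont τ₀).mul hφtc).sub ((continuous_const.mul (hw.mul (hGcont τ₀))).mul (hφc τ₀ hτ₀))
  have hbnd : ∀ᵐ c ∂volume, ∀ τ ∈ Metric.ball τ₀ r, ‖F' τ c‖ ≤ bound c :=
    ae_of_all _ fun c τ hτ => by rw [Real.norm_eq_abs]; exact hF'_le τ hτ c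
  have hbint : Integrable bound :=
    ((integrable_exp_neg_mul_sq hb).comp_sub_left c₀).const_mul _
  have hdiff : ∀ᵐ c ∂volume, ∀ τ ∈ Metric.ball τ₀ r, HasDerivAt (F · c) (F' τ c) τ := by
    refine ae_of_all _ fun c τ hτ => ?_
    obtain ⟨hτI, hsI⟩ := hball τ hτ
    have hs : 0 < ν * (t - τ) := by linarith [hsI.1]
    have hlin : HasDerivAt (fun σ : ℝ => ν * (t - σ)) (-ν) τ := by
      simpa using ((hasDerivAt_id τ).const_sub t).const_mul ν
    have hGτ : HasDerivAt (fun σ : ℝ => heatKernel (ν * (t - σ)) (c₀ - c))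
        ((((c₀ - c) ^ 2 / (4 * (ν * (t - τ)) ^ 2) - 1 / (2 * (ν * (t - τ)))) *
          heatKernel (ν * (t - τ)) (c₀ - c)) * (-ν)) τ := by
      have h := (hasDerivAt_heatKernel_time_real _ hs (c₀ - c)).comp τ hlin
      exact h
    have := hGτ.mul (hdt τ hτI c)
    refine this.congr_deriv ?_
    simp only [hF']
    ring
  exact (hasDerivAt_integral_of_dominated_loc_of_deriv_le hball_mem hmeas hint hmeas' hbnd hbint
    hdiff).2

/-- **Continuity of a caloric pairing in the time parameter.** For `H` jointly continuous and bounded on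
`(0,t) × ℝ`, `τ ↦ ∫ G_{ν(t−τ)}(c₀ − c) H(τ, c) dc` is continuous at every `τ₀ ∈ (0,t)` (dominated
convergence with the Gaussian majorant of `G` on `[s₀/2, 2s₀]`). -/
theorem continuousAt_integral_heatKernel_mul {ν t M : ℝ} (hν : 0 < ν) {H : ℝ → ℝ → ℝ} {τ₀ : ℝ}
    (hτ₀ : τ₀ ∈ Ioo 0 t) (hHc : ContinuousOn (Function.uncurry H) (Ioo 0 t ×ˢ univ))
    (hM : ∀ τ ∈ Ioo 0 t, ∀ c, |H τ c| ≤ M) (c₀ : ℝ) :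
    ContinuousAt (fun τ => ∫ c, heatKernel (ν * (t - τ)) (c₀ - c) * H τ c) τ₀ := by
  set s₀ : ℝ := ν * (t - τ₀) with hs₀
  have hs₀pos : 0 < s₀ := mul_pos hν (by linarith [hτ₀.2])
  set r : ℝ := min τ₀ ((t - τ₀) / 2) with hr
  have hr0 : 0 < r := lt_min hτ₀.1 (by linarith [hτ₀.2])
  have hball : ∀ τ ∈ Metric.ball τ₀ r, τ ∈ Ioo 0 t ∧ ν * (t - τ) ∈ Icc (s₀ / 2) (2 * s₀) := by
    intro τ hτ
    rw [Metric.mem_ball, Real.dist_eq, abs_lt] at hτ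
    have h1 : r ≤ τ₀ := min_le_left _ _
    have h2 : r ≤ (t - τ₀) / 2 := min_le_right _ _
    refine ⟨⟨by linarith, by linarith⟩, ?_, ?_⟩
    · rw [hs₀]; nlinarith
    · rw [hs₀]; nlinarith
  have hM0 : 0 ≤ M := (abs_nonneg _).trans (hM τ₀ hτ₀ 0)
  set A : ℝ := (4 * π * (s₀ / 2)) ^ (-(1 : ℝ) / 2) with hA
  have hA0 : 0 ≤ A := by positivity
  have hb : 0 < 1 / (16 * s₀) := by positivity
  have hG_le : ∀ τ ∈ Metric.ball τ₀ r, ∀ c, |heatKernel (ν * (t - τ)) (c₀ - c)| ≤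
      A * Real.exp (-(1 / (16 * s₀)) * (c₀ - c) ^ 2) := by
    intro τ hτ c
    obtain ⟨hτI, hsI⟩ := hball τ hτ
    have hs : 0 < ν * (t - τ) := by linarith [hsI.1]
    rw [abs_of_nonneg (heatKernel_real_nonneg hs _)]
    refine (heatKernel_le_gaussian_of_mem_Icc hs₀pos hsI (c₀ - c)).trans ?_
    refine mul_le_mul_of_nonneg_left (Real.exp_le_exp.2 ?_) hA0
    refine mul_le_mul_of_nonneg_right (neg_le_neg ?_) (by positivity)
    exact one_div_le_one_div_of_le (by positivity) (by linarith)
  have hball_mem : Metric.ball τ₀ r ∈ 𝓝 τ₀ := Metric.ball_mem_nhds τ₀ hr0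
  have hHcτ : ∀ τ ∈ Ioo 0 t, Continuous (H τ) := fun τ hτ => continuous_slice_right hHc hτ
  refine continuousAt_of_dominated (bound := fun c => A * Real.exp (-(1 / (16 * s₀)) * (c₀ - c) ^ 2) * M)
    ?_ ?_ ?_ ?_
  · filter_upwards [hball_mem] with τ hτ
    exact (((continuous_heatKernel (E := ℝ) _).comp (continuous_const.sub continuous_id)).mul
      (hHcτ τ (hball τ hτ).1)).aestronglyMeasurable
  · filter_upwards [hball_mem] with τ hτ
    refine ae_of_all _ fun c => ?_
    rw [Real.norm_eq_abs, abs_mul]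
    exact mul_le_mul (hG_le τ hτ c) (hM τ (hball τ hτ).1 c) (abs_nonneg _) (by positivity)
  · exact (((integrable_exp_neg_mul_sq hb).comp_sub_left c₀).const_mul A).mul_const M
  · refine ae_of_all _ fun c => ?_
    have h1 : ContinuousAt (fun τ : ℝ => heatKernel (ν * (t - τ)) (c₀ - c)) τ₀ := by
      have hd := (hasDerivAt_heatKernel_time_real _ hs₀pos (c₀ - c)).continuousAt
      have hlin : Continuous fun τ : ℝ => ν * (t - τ) := by fun_prop
      exact hd.comp_of_eq hlin.continuousAt rfl
    have h2 : ContinuousAt (fun τ => H τ c) τ₀ :=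
      (continuousOn_slice_left hHc c).continuousAt (Ioo_mem_nhds hτ₀.1 hτ₀.2)
    exact h1.mul h2

end Summit.NavierStokesRegularity.NavierStokesRegularity.Theorems.SlicedKelvinPlanarFluxAPriori

end
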